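import Literature.AnabelianGeometry.AbsoluteAnabelian.LocalResidueMapQmodZ
import Literature.NumberTheory.GaloisRepresentations.LocalGaloisGroupInertiaProofs
import HarnessLib

/-!
# The residue map under restriction to a finite extension, I: `Res : H²(Γ_F, μ) → H²(Γ_E, μ)`,
# the unramified characters, and the restriction of the canonical class

abc-iut cell, layer L4 (sub-DAG `plan/L4/SUBDAG-AbsTopIII-Prop32.md` row **P32.i.L07-model**, spec abc-iut-w4-d045;
seat abc-iut-w5-d201).  J.-P. Serre, *Corps locaux* (1968) XIII §3 Prop. 7: for a finite extension `E/F` of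
non-archimedean local fields, `inv_E ∘ Res_{E/F} = [E : F] · inv_F`; cited by [AbsTopIII] (S. Mochizuki, *Topics in
Absolute Anabelian Geometry III*, 2015) Rmk. 3.2.2 p. 73 («… a compatibility relative to dividing the `Ẑ` … by a
factor given by the index of the image of the induced open homomorphism on arithmetic Galois groups»).

For fields `F`, `E` (one universe) with `[Algebra F E]` — later MLFs of characteristic `0`, `E/F` finite,
each with its own local-field structure (valuations automatically compatible) — over the tree's
`galoisCohomology` / `DiscreteGaloisModule.mu` and THE residue maps `Prop121vii.invLevel` (`LocalResidueMapQmodZ`):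
* `Prop121vii.muRes`, `resCoeff`, **`Prop121vii.resMu F E n k : H^k(Γ_F, μ_n(F̄)) →+ H^k(Γ_E, μ_n(Ē))`** —
  the restriction along `(res : Γ_E → Γ_F, ι|μ_n)` (Mathlib `ContinuousCohomology.map`), `ι = absClosureEmbedding`;
* **`cyclicCharacter_absGaloisRestrict_eq`**: `ψ_F ∘ res = f · ψ_E` for normalised unramified characters and
  `q_E = q_F ^ f` (`absInertia_map_absGaloisRestrict_le_holds`, `IsFrobPow.absGaloisRestrict_holds`, Weil
  density `range_eq_zpowers_of_absInertia_le_ker`);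
* `Prop121vii.baseUnitsInvariant` and **`resMu_cupProduct_δ₀_scalarCocycle`**: `Res (κ_n(x) ∪ [ψ_F·id])` is
  the class `κ_n(f·(x)_E) ∪ [ψ_E·id]` — naturality of the Kummer connecting map and of the cup product under
  `(res, ι|μ_n)` on inhomogeneous cocycles (Neukirch–Schmidt–Wingberg I §4 (1.4.2));
* `resMu_cohomologyMap_muInclHom` and **`Prop121vii.H2MuQZ.res : H²(Γ_F, μ_{ℚ/ℤ}) →+ H²(Γ_E, μ_{ℚ/ℤ})`**.

The index formula itself (`invLevel_resMu`, `invariantQZEquiv_res`) is the sequel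
`LocalResidueMapRestrictionIndex.lean`.  HONEST FRAMING: textbook material (Serre, NSW); constructions and
proofs over the tree's real objects; no named fact introduced; nothing here bears on [IUTchIII] Cor. 3.12
or takes a side.
-/

noncomputable section

universe u

namespace Literature.AnabelianGeometry.AbsoluteAnabelian

open Field Function IntermediateField CategoryTheory
open Literature.NumberTheory.GaloisRepresentations
open Literature.NumberTheory.GaloisRepresentations.DiscreteGaloisModule
open Literature.NumberTheory.GaloisRepresentations.LocalWeilDatum
open Literature.NumberTheory.GaloisRepresentations.IsNonarchimedeanLocalField
open ValuativeRel

namespace Prop121vii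

/-! ### §1. The coefficient map `μ_n(F̄) → μ_n(Ē)` and the restriction on `H^k(·, μ_n)` -/

section Coeff

variable (F E : Type u) [Field F] [Field E] [Algebra F E] (n : ℕ)

/-- `μ_n(F̄) → μ_n(Ē)` on the additive carriers, along the chosen `F`-embedding
`ι = absClosureEmbedding F E : F̄ → Ē`. [cite: SerreGaloisCohomology1997, I §2.4] -/
def muRes : MuCarrier F n →+ MuCarrier E n where
  toFun v := muOfUnit E n (Units.map (absClosureEmbedding F E).toRingHom.toMonoidHom (muVal F n v))
    (by rw [← map_pow, muVal_pow_eq_one, map_one])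
  map_zero' := muVal_injective E n (by rw [muVal_muOfUnit, muVal_zero, muVal_zero, map_one])
  map_add' v w := muVal_injective E n (by
    rw [muVal_muOfUnit, muVal_add, muVal_add, muVal_muOfUnit, muVal_muOfUnit, map_mul])

/-- `muVal (muRes v) = ι (muVal v)`. [cite: SerreGaloisCohomology1997, I §2.4] -/
@[simp] theorem muVal_muRes (v : MuCarrier F n) :
    muVal E n (muRes F E n v) =
      Units.map (absClosureEmbedding F E).toRingHom.toMonoidHom (muVal F n v) := rfl

/-- On underlying elements of `Ē`, `muRes` is `ι`. [cite: SerreGaloisCohomology1997, I §2.4] -/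
theorem coe_muVal_muRes (v : MuCarrier F n) :
    ((muVal E n (muRes F E n v) : (AlgebraicClosure E)ˣ) : AlgebraicClosure E) =
      absClosureEmbedding F E ((muVal F n v : (AlgebraicClosure F)ˣ) : AlgebraicClosure F) := rfl

/-- **`Γ_E`-equivariance of `μ_n(F̄) → μ_n(Ē)` over the restriction `Γ_E → Γ_F`**:
`muRes ((res σ) · v) = σ · muRes v` (`ι (res σ • x) = σ • ι x`): `(res, ι|μ_n)` is a compatible pair.
[cite: SerreGaloisCohomology1997, I §2.4] -/
theorem muRes_smul (σ : absoluteGaloisGroup E) (v : MuCarrier F n) :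
    muRes F E n (mu F n (absGaloisRestrict F E σ) v) = mu E n σ (muRes F E n v) := by
  apply muVal_injective E n
  refine Units.ext ?_
  rw [muVal_apply, Units.coe_smul, coe_muVal_muRes, coe_muVal_muRes, muVal_apply, Units.coe_smul,
    absGaloisRestrict_apply_smul]

/-- The coefficient morphism `μ_n(F̄)|_{Γ_E} → μ_n(Ē)` over `res : Γ_E → Γ_F`, as a morphism of
topological `Γ_E`-representations (Mathlib `TopRep.res`). [cite: SerreGaloisCohomology1997, I §2.4] -/
def resCoeff :
    TopRep.res (absGaloisRestrict F E : absoluteGaloisGroup E →* absoluteGaloisGroup F) (mu F n).toTopRep ⟶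
      (mu E n).toTopRep :=
  TopRep.ofHom ⟨⟨(muRes F E n).toIntLinearMap, continuous_of_discreteTopology⟩, fun σ => by
    refine ContinuousLinearMap.ext fun v => ?_
    exact muRes_smul F E n σ v⟩

/-- `resCoeff` on elements is `muRes`. [cite: SerreGaloisCohomology1997, I §2.4] -/
@[simp] theorem resCoeff_hom_apply (v : MuCarrier F n) : (resCoeff F E n).hom v = muRes F E n v := rfl

/-- **The restriction `Res : H^k(Γ_F, μ_n(F̄)) → H^k(Γ_E, μ_n(Ē))`** for an extension `E/F`
(pull back along `res : Γ_E → Γ_F`, change coefficients along `ι : μ_n(F̄) ⥲ μ_n(Ē)`;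
Mathlib `ContinuousCohomology.map`). [cite: SerreLocalFields1979, XIII §3 Prop. 7] -/
def resMu (k : ℕ) : galoisCohomology (mu F n) k →+ galoisCohomology (mu E n) k :=
  (ContinuousCohomology.map (absGaloisRestrict F E) (resCoeff F E n) k).hom.toLinearMap.toAddMonoidHom

/-- `resMu` is Mathlib's `ContinuousCohomology.map` on elements. [cite: SerreGaloisCohomology1997, I §2.4] -/
theorem resMu_apply (k : ℕ) (x : galoisCohomology (mu F n) k) :
    resMu F E n k x = ContinuousCohomology.map (absGaloisRestrict F E) (resCoeff F E n) k x := rfl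

end Coeff

/-! ### §2. The normalised unramified characters under restriction: `ψ_F ∘ res = f · ψ_E` -/

section Character

variable (F E : Type u) [Field F] [ValuativeRel F] [TopologicalSpace F] [IsNonarchimedeanLocalField F]
  [Field E] [ValuativeRel E] [TopologicalSpace E] [IsNonarchimedeanLocalField E] [Algebra F E]
  {n : ℕ}

/-- A character `ψ : Γ_F → ℤ/n` killing inertia and normalised at Frobenius (`ψ = 1` on every
arithmetic-Frobenius lift) takes the value `f` on every Frobenius power of exponent `f`
(`ρ = (ρ φ^{-f}) φ^f` with `ρ φ^{-f} ∈ I_F`). [cite: SerreLocalFields1979, XIII §4 Prop. 13] -/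
theorem cyclicCharacter_apply_of_isFrobPow (ψ : CyclicCharacter (absoluteGaloisGroup F) n)
    (hI : ∀ σ ∈ absInertia F, ψ σ = 0) (hF : ∀ σ : absoluteGaloisGroup F, IsFrobPow σ 1 → ψ σ = 1)
    {ρ : absoluteGaloisGroup F} {f : ℕ} (hρ : IsFrobPow ρ (f : ℤ)) : ψ ρ = (f : ZMod n) := by
  obtain ⟨φ, hφ⟩ := exists_isAbsArithFrob_holds F
  have hφ1 : IsFrobPow φ 1 := IsAbsArithFrob.isFrobPow_holds hφ
  have hφf : IsFrobPow (φ ^ f) (f : ℤ) := by simpa using hφ1.pow f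
  have hmem : ρ * (φ ^ f)⁻¹ ∈ absInertia F := IsFrobPow.mul_inv_mem_absInertia_holds hρ hφf
  have h0 := hI _ hmem
  rw [ψ.map_mul, ψ.map_inv, ψ.map_pow, hF φ hφ1, ← sub_eq_add_neg, sub_eq_zero] at h0
  rw [h0, nsmul_eq_mul, mul_one]

/-- **`ψ_F ∘ res = f · ψ_E`**: for normalised unramified characters `ψ_F` of `Γ_F` and `ψ_E` of
`Γ_E` (killing inertia, `= 1` on Frobenius lifts) and `f` the residue degree of `E/F`
(`q_E = q_F ^ f`), the restriction of `ψ_F` along `res : Γ_E → Γ_F` is `f · ψ_E` — `res` maps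
`I_E` into `I_F` and a Frobenius of `E` to a Frobenius power of exponent `f`
(`absInertia_map_absGaloisRestrict_le_holds`, `IsFrobPow.absGaloisRestrict_holds`), and
`Γ_E/I_E` is topologically generated by Frobenius (Weil density,
`range_eq_zpowers_of_absInertia_le_ker`). [cite: SerreLocalFields1979, XIII §4 Prop. 13] -/
theorem cyclicCharacter_absGaloisRestrict_eq
    (ψF : CyclicCharacter (absoluteGaloisGroup F) n) (ψE : CyclicCharacter (absoluteGaloisGroup E) n)
    (hIF : ∀ σ ∈ absInertia F, ψF σ = 0) (hFF : ∀ σ : absoluteGaloisGroup F, IsFrobPow σ 1 → ψF σ = 1)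
    (hIE : ∀ σ ∈ absInertia E, ψE σ = 0) (hFE : ∀ σ : absoluteGaloisGroup E, IsFrobPow σ 1 → ψE σ = 1)
    {f : ℕ} (hf : residueFieldCard E = residueFieldCard F ^ f) (σ : absoluteGaloisGroup E) :
    ψF (absGaloisRestrict F E σ) = (f : ZMod n) * ψE σ := by
  -- the difference character `d : Γ_E → ℤ/n` (written multiplicatively)
  let d : absoluteGaloisGroup E →* Multiplicative (ZMod n) :=
    { toFun := fun τ => Multiplicative.ofAdd (ψF (absGaloisRestrict F E τ) - (f : ZMod n) * ψE τ)
      map_one' := by rw [map_one, ψF.map_one, ψE.map_one, mul_zero, sub_zero]; rfl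
      map_mul' := fun τ τ' => by
        rw [← ofAdd_add, map_mul, ψF.map_mul, ψE.map_mul]
        congr 1
        ring }
  have hd : ∀ τ, d τ = Multiplicative.ofAdd (ψF (absGaloisRestrict F E τ) - (f : ZMod n) * ψE τ) :=
    fun τ => rfl
  -- its kernel is open (coincidence set of a continuous map into a discrete space)
  have hcont : Continuous fun τ : absoluteGaloisGroup E =>
      ψF (absGaloisRestrict F E τ) - (f : ZMod n) * ψE τ := by
    have h1 : Continuous fun τ : absoluteGaloisGroup E => (ψF (absGaloisRestrict F E τ), ψE τ) :=
      (ψF.continuous.comp (absGaloisRestrict F E).continuous).prodMk ψE.continuous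
    exact (continuous_of_discreteTopology (f := fun p : ZMod n × ZMod n => p.1 - (f : ZMod n) * p.2)).comp h1
  have hker : (d.ker : Set (absoluteGaloisGroup E)) =
      (fun τ => ψF (absGaloisRestrict F E τ) - (f : ZMod n) * ψE τ) ⁻¹' {0} := by
    ext τ
    simp only [SetLike.mem_coe, MonoidHom.mem_ker, Set.mem_preimage, Set.mem_singleton_iff, hd]
    exact ⟨fun h => Multiplicative.ofAdd.injective (h.trans ofAdd_zero.symm),
      fun h => by rw [h, ofAdd_zero]⟩
  have hopen : IsOpen ((d.ker : Subgroup _) : Set (absoluteGaloisGroup E)) := by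
    rw [hker]
    exact (isOpen_discrete _).preimage hcont
  -- it contains the inertia group of `E`
  have hIker : absInertia E ≤ d.ker := fun τ hτ => by
    have hτF : absGaloisRestrict F E τ ∈ absInertia F :=
      absInertia_map_absGaloisRestrict_le_holds F E (Subgroup.mem_map_of_mem _ hτ)
    rw [MonoidHom.mem_ker, hd, hIF _ hτF, hIE τ hτ, mul_zero, sub_zero, ofAdd_zero]
  -- and an arithmetic Frobenius of `E`
  obtain ⟨φ, hφ⟩ := exists_isAbsArithFrob_holds E
  have hφ1 : IsFrobPow φ 1 := IsAbsArithFrob.isFrobPow_holds hφ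
  have hres : IsFrobPow (absGaloisRestrict F E φ) ((f : ℤ) * 1) :=
    IsFrobPow.absGaloisRestrict_holds F hφ1 f hf
  rw [mul_one] at hres
  have hdφ : d φ = 1 := by
    rw [hd, cyclicCharacter_apply_of_isFrobPow F ψF hIF hFF hres, hFE φ hφ1, mul_one, sub_self,
      ofAdd_zero]
  have hrange := IsNonarchimedeanLocalField.range_eq_zpowers_of_absInertia_le_ker d hopen hIker hφ
  rw [hdφ, Subgroup.zpowers_one_eq_bot] at hrange
  have hσ : d σ ∈ d.range := ⟨σ, rfl⟩
  rw [hrange, Subgroup.mem_bot, hd] at hσ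
  exact sub_eq_zero.1 (Multiplicative.ofAdd.injective (hσ.trans ofAdd_zero.symm))

end Character

/-! ### §3. Base invariants and the restriction of the canonical class -/

section BaseInvariant

variable (K : Type u) [Field K]

/-- A non-zero `x ∈ K` as a `Γ_K`-invariant of the discrete module `K̄ˣ` (value `x ∈ K̄ˣ`):
`K^× = (K̄ˣ)^{Γ_K}`. [cite: SerreGaloisCohomology1997, II §1.2] -/
def baseUnitsInvariant (x : K) (hx : x ≠ 0) : (units K).toTopRep.ρ.invariants :=
  ⟨UnitsCarrier.ofUnits (Units.mk0 (algebraMap K (AlgebraicClosure K) x)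
      ((map_ne_zero_iff _ (algebraMap K (AlgebraicClosure K)).injective).2 hx)), fun σ => by
    apply unitsVal_injective K
    rw [ContinuousRep.toTopRep_ρ_apply, unitsVal_apply, unitsVal_ofUnits]
    ext
    rw [Units.coe_smul, Units.val_mk0]
    exact σ.commutes x⟩

/-- The value of `baseUnitsInvariant K x` in `K̄` is `x`. [cite: SerreGaloisCohomology1997, II §1.2] -/
@[simp] theorem coe_unitsVal_baseUnitsInvariant (x : K) (hx : x ≠ 0) :
    (unitsVal K (baseUnitsInvariant K x hx : UnitsCarrier K) : AlgebraicClosure K) =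
      algebraMap K (AlgebraicClosure K) x := rfl

/-- `baseUnitsInvariant` is multiplicative: `x y ↦ (x) + (y)` (additive notation on `K̄ˣ`).
[cite: SerreGaloisCohomology1997, II §1.2] -/
theorem baseUnitsInvariant_mul (x y : K) (hx : x ≠ 0) (hy : y ≠ 0) :
    baseUnitsInvariant K (x * y) (mul_ne_zero hx hy) = baseUnitsInvariant K x hx + baseUnitsInvariant K y hy := by
  apply Subtype.ext
  apply unitsVal_injective K
  refine Units.ext ?_
  rw [Submodule.coe_add, unitsVal_add, Units.val_mul, coe_unitsVal_baseUnitsInvariant,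
    coe_unitsVal_baseUnitsInvariant, coe_unitsVal_baseUnitsInvariant, map_mul]

/-- `baseUnitsInvariant` on powers: `x ^ k ↦ k • (x)`. [cite: SerreGaloisCohomology1997, II §1.2] -/
theorem baseUnitsInvariant_pow (x : K) (hx : x ≠ 0) (k : ℕ) :
    baseUnitsInvariant K (x ^ k) (pow_ne_zero k hx) = (k : ℤ) • baseUnitsInvariant K x hx := by
  apply Subtype.ext
  apply unitsVal_injective K
  refine Units.ext ?_
  rw [Submodule.coe_smul, unitsVal_zsmul, zpow_natCast, Units.val_pow_eq_pow_val,
    coe_unitsVal_baseUnitsInvariant, coe_unitsVal_baseUnitsInvariant, map_pow]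

end BaseInvariant

section Canonical

variable (F E : Type u) [Field F] [Field E] [Algebra F E] {n : ℕ} [NeZero n]

/-- `unitsVal (u - v) = unitsVal u / unitsVal v`. [folklore] -/
private theorem unitsVal_sub' (K : Type u) [Field K] (u v : UnitsCarrier K) :
    unitsVal K (u - v) = unitsVal K u / unitsVal K v := rfl

/-- `ι (algebraMap F F̄ x) = algebraMap E Ē (algebraMap F E x)`. [folklore] -/
private theorem absClosureEmbedding_algebraMap (x : F) :
    absClosureEmbedding F E (algebraMap F (AlgebraicClosure F) x) =
      algebraMap E (AlgebraicClosure E) (algebraMap F E x) := by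
  rw [(absClosureEmbedding F E).commutes x, IsScalarTower.algebraMap_apply F E (AlgebraicClosure E)]

omit [NeZero n] in
/-- Reduction of an integer multiple modulo `n` on an `n`-torsion element. [folklore] -/
private theorem val_mul_natCast_zsmul {M : Type*} [AddCommGroup M] (f : ℕ) (a : ZMod n) (m : M)
    (hm : (n : ℤ) • m = 0) :
    ((((f : ZMod n) * a).val : ℤ)) • m = (f : ℤ) • (((a.val : ℤ)) • m) := by
  have hs : (f * a.val : ℕ) = ((f : ZMod n) * a).val + n * ((f * a.val) / n) := by
    rw [ZMod.val_mul, ZMod.val_natCast, Nat.mod_mul_mod, Nat.mod_add_div]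
  have hz : (f : ℤ) * ((a.val : ℤ)) =
      ((((f : ZMod n) * a).val : ℤ)) + (((f * a.val) / n : ℕ) : ℤ) * (n : ℤ) := by
    rw [mul_comm (((f * a.val) / n : ℕ) : ℤ)]; exact_mod_cast hs
  rw [← mul_smul, hz, add_smul, mul_smul, hm, smul_zero, add_zero]

/-- **Restriction of the canonical class.**  For cyclic characters `ψ_F`, `ψ_E` with
`ψ_F ∘ res = f · ψ_E` and `x ∈ F^×`: the restriction `Res : H²(Γ_F, μ_n) → H²(Γ_E, μ_n)` carries
`κ_n(x) ∪ [ψ_F·id]` to `f · (κ_n(x)_E ∪ [ψ_E·id])`, `κ_n(x)_E` the Kummer class of `x` viewed in `E`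
(naturality of the Kummer connecting map and of the cup product under the compatible pair
`(res, ι|μ_n)`, computed on inhomogeneous cocycles). [cite: NeukirchSchmidtWingberg2008, I §4 (1.4.2)] -/
theorem resMu_cupProduct_δ₀_scalarCocycle (ψF : CyclicCharacter (absoluteGaloisGroup F) n)
    (ψE : CyclicCharacter (absoluteGaloisGroup E) n) {f : ℕ}
    (hψ : ∀ σ : absoluteGaloisGroup E, ψF (absGaloisRestrict F E σ) = (f : ZMod n) * ψE σ)
    (x : F) (hx : x ≠ 0) (hx' : algebraMap F E x ≠ 0) :
    haveI : CompactSpace (absoluteGaloisGroup F) := absoluteGaloisGroup_compactSpace F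
    haveI : CompactSpace (absoluteGaloisGroup E) := absoluteGaloisGroup_compactSpace E
    resMu F E n 2 (((mu F n).tateDualPairing n).cupProduct
        ((isSES_kummer F n (NeZero.pos n)).δ₀ (baseUnitsInvariant F x hx)) (oneCocycleClass _ (scalarCocycle ψF))) =
      ((mu E n).tateDualPairing n).cupProduct
        ((isSES_kummer E n (NeZero.pos n)).δ₀ ((f : ℤ) • baseUnitsInvariant E (algebraMap F E x) hx'))
        (oneCocycleClass _ (scalarCocycle ψE)) := by
  haveI : CompactSpace (absoluteGaloisGroup F) := absoluteGaloisGroup_compactSpace F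
  haveI : CompactSpace (absoluteGaloisGroup E) := absoluteGaloisGroup_compactSpace E
  have hn : 0 < n := NeZero.pos n
  have hF := isSES_kummer F n hn
  have hE := isSES_kummer E n hn
  set uF := baseUnitsInvariant F x hx with huF
  set uE := baseUnitsInvariant E (algebraMap F E x) hx' with huE
  -- an `n`-th root `w` of `x` in `F̄ˣ`, and its image `w'` in `Ēˣ`
  obtain ⟨w, hw⟩ := hF.surjective (uF : UnitsCarrier F)
  have hwn : unitsVal F w ^ n = unitsVal F (uF : UnitsCarrier F) := by
    have e := congrArg (unitsVal F) hw
    rwa [kummerπ_hom_apply, unitsVal_zsmul, zpow_natCast] at e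
  let ι : (AlgebraicClosure F)ˣ →* (AlgebraicClosure E)ˣ :=
    Units.map (absClosureEmbedding F E).toRingHom.toMonoidHom
  have hι : ∀ y : (AlgebraicClosure F)ˣ, ((ι y : (AlgebraicClosure E)ˣ) : AlgebraicClosure E) =
      absClosureEmbedding F E (y : AlgebraicClosure F) := fun y => rfl
  let w' : UnitsCarrier E := UnitsCarrier.ofUnits (ι (unitsVal F w))
  have hw' : (kummerπ E n).hom w' = (uE : UnitsCarrier E) := by
    apply unitsVal_injective E
    rw [kummerπ_hom_apply, unitsVal_zsmul, zpow_natCast]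
    change ι (unitsVal F w) ^ n = unitsVal E (uE : UnitsCarrier E)
    rw [← map_pow, hwn]
    refine Units.ext ?_
    rw [hι, huF, coe_unitsVal_baseUnitsInvariant, huE, coe_unitsVal_baseUnitsInvariant,
      absClosureEmbedding_algebraMap]
  have hwinv : (kummerπ F n).hom w ∈ (units F).toTopRep.ρ.invariants := by rw [hw]; exact uF.2
  have hw'inv : (kummerπ E n).hom w' ∈ (units E).toTopRep.ρ.invariants := by rw [hw']; exact uE.2
  -- the lift `f • w'` of `f • (x)_E`
  have hfw' : (kummerπ E n).hom ((f : ℤ) • w') = (((f : ℤ) • uE : (units E).toTopRep.ρ.invariants) :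
      UnitsCarrier E) := by
    rw [map_zsmul, hw', Submodule.coe_smul]
  have hfw'inv : (kummerπ E n).hom ((f : ℤ) • w') ∈ (units E).toTopRep.ρ.invariants := by
    rw [hfw']; exact ((f : ℤ) • uE).2
  -- the Kummer cocycles correspond under `(res, ι)`
  have hδ : ∀ σ : absoluteGaloisGroup E,
      muRes F E n ((hF.δ₀Cocycle w hwinv).1 (absGaloisRestrict F E σ)) = (hE.δ₀Cocycle w' hw'inv).1 σ := by
    intro σ
    apply hE.injective
    apply unitsVal_injective E
    rw [hE.f_δ₀Cocycle_apply, unitsVal_kummerι, muVal_muRes, ← unitsVal_kummerι, hF.f_δ₀Cocycle_apply,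
      unitsVal_sub', unitsVal_sub', map_div, unitsVal_apply, unitsVal_apply]
    congr 1
    refine Units.ext ?_
    change absClosureEmbedding F E (((absGaloisRestrict F E σ • unitsVal F w : (AlgebraicClosure F)ˣ) :
      AlgebraicClosure F)) = ((σ • ι (unitsVal F w) : (AlgebraicClosure E)ˣ) : AlgebraicClosure E)
    rw [Units.coe_smul, Units.coe_smul, absGaloisRestrict_apply_smul]
    rfl
  -- the Kummer cocycle of the lift `f • w'` is `f •` that of `w'`
  have hδf : ∀ σ : absoluteGaloisGroup E,
      (hE.δ₀Cocycle ((f : ℤ) • w') hfw'inv).1 σ = (f : ℤ) • (hE.δ₀Cocycle w' hw'inv).1 σ := by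
    intro σ
    apply hE.injective
    rw [hE.f_δ₀Cocycle_apply, map_zsmul, map_zsmul, hE.f_δ₀Cocycle_apply, smul_sub]
  -- both sides on explicit cocycles
  rw [hF.δ₀_apply_eq uF w hw, hE.δ₀_apply_eq ((f : ℤ) • uE) ((f : ℤ) • w') hfw',
    ContPairing.cupProduct_oneCocycleClass_eq_twoCocycleClass,
    ContPairing.cupProduct_oneCocycleClass_eq_twoCocycleClass, resMu_apply, map_twoCocycleClass]
  refine congrArg (twoCocycleClass _) (Subtype.ext (ContinuousMap.ext fun p => ?_))
  obtain ⟨σ, τ⟩ := p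
  have hsubF : ∀ (h h' : TateDual F (MuCarrier F n) n) (m : MuCarrier F n), (h - h') m = h m - h' m :=
    fun _ _ _ => rfl
  have hsubE : ∀ (h h' : TateDual E (MuCarrier E n) n) (m : MuCarrier E n), (h - h') m = h m - h' m :=
    fun _ _ _ => rfl
  have htors : (n : ℤ) • ((hE.δ₀Cocycle w' hw'inv).1 σ) = 0 := zsmul_muCarrier_eq_zero E n _
  rw [contTwoCocycles.pullback_apply, ContPairing.cupCocycle_apply, ContPairing.cupCocycle_apply,
    resCoeff_hom_apply]
  change muRes F E n
      ((((ψF (absGaloisRestrict F E σ * absGaloisRestrict F E τ)).val : ℤ) •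
          ((hF.δ₀Cocycle w hwinv).1 (absGaloisRestrict F E σ) : MuCarrier F n)) -
        (((ψF (absGaloisRestrict F E σ)).val : ℤ) •
          ((hF.δ₀Cocycle w hwinv).1 (absGaloisRestrict F E σ) : MuCarrier F n))) =
    ((((ψE (σ * τ)).val : ℤ) • ((hE.δ₀Cocycle ((f : ℤ) • w') hfw'inv).1 σ : MuCarrier E n)) -
      (((ψE σ).val : ℤ) • ((hE.δ₀Cocycle ((f : ℤ) • w') hfw'inv).1 σ : MuCarrier E n)))
  rw [← map_mul, hψ, hψ, hδf, map_sub, map_zsmul, map_zsmul, hδ, val_mul_natCast_zsmul f _ _ htors,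
    val_mul_natCast_zsmul f _ _ htors, smul_comm (f : ℤ) (((ψE (σ * τ)).val : ℤ)),
    smul_comm (f : ℤ) (((ψE σ).val : ℤ))]

end Canonical

/-! ### §4. The colimit map `Res : H²(Γ_F, μ_{ℚ/ℤ}) → H²(Γ_E, μ_{ℚ/ℤ})` -/

section Colimit

variable (F E : Type u) [Field F] [Field E] [Algebra F E]

/-- `Res` commutes with the transition maps `H²(μ_n ⊆ μ_N)` (`n ∣ N`) (functoriality of the compatible-pair
maps). [cite: SerreGaloisCohomology1997, I §2.4] -/
theorem resMu_cohomologyMap_muInclHom {n N : ℕ} (h : n ∣ N) (x : galoisCohomology (mu F n) 2) :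
    haveI : CompactSpace (absoluteGaloisGroup F) := absoluteGaloisGroup_compactSpace F
    haveI : CompactSpace (absoluteGaloisGroup E) := absoluteGaloisGroup_compactSpace E
    resMu F E N 2 (cohomologyMap (muInclHom F h) 2 x) = cohomologyMap (muInclHom E h) 2 (resMu F E n 2 x) := by
  haveI : CompactSpace (absoluteGaloisGroup F) := absoluteGaloisGroup_compactSpace F
  haveI : CompactSpace (absoluteGaloisGroup E) := absoluteGaloisGroup_compactSpace E
  obtain ⟨c, rfl⟩ := twoCocycleClass_surjective _ x
  rw [resMu_apply, resMu_apply, map_twoCocycleClass, map_twoCocycleClass, map_twoCocycleClass,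
    map_twoCocycleClass]
  refine congrArg (twoCocycleClass _) (Subtype.ext (ContinuousMap.ext fun p => ?_))
  obtain ⟨σ, τ⟩ := p
  rw [contTwoCocycles.pullback_apply, contTwoCocycles.pullback_apply, contTwoCocycles.pullback_apply,
    contTwoCocycles.pullback_apply, resCoeff_hom_apply, resCoeff_hom_apply, resIdHom_hom_apply,
    resIdHom_hom_apply, muInclHom_hom_apply, muInclHom_hom_apply]
  apply muVal_injective E N
  rw [muVal_muRes, muVal_muInclusion, muVal_muInclusion, muVal_muRes]
  rfl

/-- **`Res : H²(Γ_F, μ_{ℚ/ℤ}(F̄)) → H²(Γ_E, μ_{ℚ/ℤ}(Ē))`** on the colimits `colim_n H²(·, μ_n)` (the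
levelwise restrictions are compatible with `μ_n ⊆ μ_N`). [cite: SerreLocalFields1979, XIII §3 Prop. 7] -/
def H2MuQZ.res : H2MuQZ F →+ H2MuQZ E :=
  AddCommGroup.DirectLimit.lift (fun m : DivLevel => galoisCohomology (mu F (m.val : ℕ)) 2) (H2MuSystem F)
    (H2MuQZ E) (fun m => (H2MuQZ.of m.val).comp (resMu F E (m.val : ℕ) 2))
    (fun i j hij x => by
      rw [AddMonoidHom.comp_apply, AddMonoidHom.comp_apply, H2MuSystem_apply,
        resMu_cohomologyMap_muInclHom]
      exact H2MuQZ.of_cohomologyMap (DivLevel.le_iff.1 hij) _)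

/-- `Res` on a level-`n` class is the levelwise `Res`. [cite: SerreLocalFields1979, XIII §3 Prop. 7] -/
theorem H2MuQZ.res_of (n : ℕ+) (x : galoisCohomology (mu F (n : ℕ)) 2) :
    H2MuQZ.res F E (H2MuQZ.of n x) = H2MuQZ.of n (resMu F E (n : ℕ) 2 x) :=
  AddCommGroup.DirectLimit.lift_of (G := fun m : DivLevel => galoisCohomology (mu F (m.val : ℕ)) 2)
    (f := H2MuSystem F) _ _ _ (DivLevel.ofPNat n) x

end Colimit

end Prop121vii

end Literature.AnabelianGeometry.AbsoluteAnabelian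

end
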